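import Literature.AlgebraicGeometry.ModuliOfAbelianVarieties.SiegelPairingReadOfTypeFrame   -- ★ p725410 (F10): one marking
import HarnessLib

/-!
# Pairing readings through `r` for a FAMILY of markings, with ONE system of roots of unity (U-e P4b socket (B4):
# `IsFlatGram ⇒ ∃ ζ, IsFlatPairingReading`)

Topic `AlgebraicGeometry/ModuliOfAbelianVarieties`; namespace `Literature.AlgebraicGeometry.ModuliOfAbelianVarieties`.
KERNEL ONLY: theorems; no definition, no named fact, no instance, no `sorry`.  Cell hodgecm-mathlib (D-0151), (U)-HEAD node
U-e, socket P4, B-p05 (g13)'s third layer v0.4 §8 socket `UHead.Ue_P4b4_pairingReadings_of_flatGram` (B-typ02 (g11)'s notions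
`SiegelMarkingFamily.IsFlatGram` / `IsFlatPairingReading`, HOME-only; their bodies are reproduced here over a bare family of markings
`m x : SiegelAdelicMarking (J x) (a x) (A x)`); hand B-p03 (g13).  HC_CM is proved only modulo the 7 printed citations until rung 0
closes; books 0.

The one-marking change of reading ★ `SiegelAdelicMarking.exists_pairingRead_of_pairingRead` ([Deligne1971TravauxShimura] 4.16: change
of the symplectic similitude `ẑ^{2g} ⥲ T̂(A)` by `k ∈ GSp_δ(ẑ)`) produces a twisted system `ζ′_M = ζ_M ^ ν̄_M(k)` which depends
ONLY on the similitude tower of `k = b₁⁻¹ b₂` (★ `exists_similitudeTower`), not on the marked abelian variety — but its `∃ ζ′` hides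
this.  For a FAMILY of marked fibres read through the same `b₁ ↦ b₂` the P4b glue needs ONE `ζ′` for all members
(`IsFlatPairingReading Θ N ζ′` quantifies `ζ′` outside the fibre); this file re-runs the ★ argument with the tower extracted BEFORE
the fibre is fixed:

* `SiegelAdelicMarking.exists_pairingRead_forall_of_pairingRead_forall` — family change of reading `b₁ ↦ b₂` with one `ζ′`;
* `SiegelAdelicMarking.exists_pairingRead_forall_of_intGram_eq_typeForm` — **(B4)**: a family of markings by `[J x, r]`
  (`r ∈ K_δ(1)`, basis matrices `γ = 1`) whose own uniformisations carry Appell–Humbert data of `[𝒪(Θ x)^an]` with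
  `intGram = typeForm δ` at every `x` (= `IsFlatGram Θ`) has pairing readings through `r` with ONE compatible system of primitive
  roots `ζ` at every `x` (= `∃ ζ, IsFlatPairingReading Θ N ζ`): through `1` the system is `e(2πi/M)` at every fibre (★ (F10)
  `pairingRead_one_of_intGram_eq_typeForm`), then the family change of reading `1 ↦ r`.

The hypothesis `γ = 1` is NECESSARY for `g ≥ 2`: `IsFlatGram` computes the Gram matrix in the `Ψ`-standard frame while the readings
`(m x).r` go through `γ⁻¹ ∈ GL_{2g}(ℤ)`, which need not be a similitude of `E_δ` (the re-based markings of the uniformisation road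
have `γ = 1` by construction, ★ `exists_siegelAdelicMarking_of_hodgeFrame`).

## References
* [Milne2005ShimuraVarieties] J. S. Milne, *Introduction to Shimura varieties* (2005), §6 Thm. 6.11 pp. 74–75 («`ηK`», «`s` (resp. `ψ`)
  a `(ℤ/Nℤ)^×`-multiple»), §12 (63) p. 116.
* [Deligne1971TravauxShimura] P. Deligne, *Travaux de Shimura*, Sém. Bourbaki 389 (1971), 4.12 (b) pp. 148–149, Exemple 4.16 p. 150.
* [Lan2013PELCompactifications] K.-W. Lan, *Arithmetic compactifications of PEL-type Shimura varieties* (2013), §1.3.6 Lemma 1.3.6.5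
  (p. 81).
-/

set_option autoImplicit false

noncomputable section

open Matrix NumberField IsDedekindDomain CategoryTheory AlgebraicGeometry

namespace Literature.AlgebraicGeometry.ModuliOfAbelianVarieties

open Literature.AlgebraicGeometry.Motives (AbelianVariety AlgPoints CartierDivisor specOver ComplexPoints)
open Literature.AlgebraicGeometry.AbelianSchemes (AbelianSchemeOver PolarizedAbelianSchemeWithLevel)
open Literature.Geometry.Kaehler (ComplexTorus)
open Literature.Geometry.Kaehler.ComplexTorus (AHData proj intGram picClass)
open Literature.NumberTheory.Transcendental (IsAnalytification)
open Literature.AlgebraicGeometry.HodgeTheory (cartierDivisorLineBundle)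
open Literature.NumberTheory.Adeles
open Literature.NumberTheory.Automorphic (siegelUpperHalfSpace)
open SiegelModuli

variable {g : ℕ} {δ : Fin g → ℕ}

/-- Powers of an `M`-th root of unity depend only on the exponent mod `M` (local copy of the bookkeeping lemma of ★
`SiegelAdmissibleExistence`, which is `private` there). [folklore] -/
private theorem pow_eq_pow_mod_of_pow_eq_one {z : ℂ} {M : ℕ} (h : z ^ M = 1) (a : ℕ) : z ^ a = z ^ (a % M) := by
  conv_lhs => rw [← Nat.mod_add_div a M]
  rw [pow_add, pow_mul, h, one_pow, mul_one]

namespace SiegelAdelicMarking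

variable {ι : Type*} {A : ι → AbelianVariety ℂ} {J : ι → C0pm δ} {a : ι → gspFinAdelic δ}

/-! ### §1 The family change of reading `b₁ ↦ b₂` with ONE twisted system of roots of unity -/

/-- **FAMILY FRAME CHANGE FOR THE PAIRING READINGS** (★ `exists_pairingRead_of_pairingRead` with the marking quantified INSIDE):
for a family of marked abelian varieties `(A x, m x)`, divisors `Θ x`, `b₁, b₂ ∈ K_δ(1)` and ONE compatible system of primitive roots
`ζ` such that at EVERY `x` the Weil pairing of `Θ x` on `M`-torsion points read through `b₁` is `ζ_M ^ E_δ`, there is ONE compatible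
system `ζ′` (namely `ζ′_M = ζ_M ^ ν̄_M`, `ν̄` the multiplier tower of `k = b₁⁻¹ b₂`, ★ `exists_similitudeTower` — independent of `x`) such
that at every `x` the readings through `b₂` are `ζ′_M ^ E_δ`. [cite: Deligne1971TravauxShimura, 4.12 (b) pp. 148–149 and Exemple 4.16 p. 150]
[cite: Milne2005ShimuraVarieties, §6 Thm. 6.11 p. 74 and p. 75] -/
theorem exists_pairingRead_forall_of_pairingRead_forall (hδ : IsPolarizationType δ) (hg : 0 < g)
    (m : ∀ x, SiegelAdelicMarking (J x) (a x) (A x)) (Θ : ∀ x, CartierDivisor (A x).X.left) {N : ℕ}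
    {b₁ b₂ : gspFinAdelic δ} (hb₁ : b₁ ∈ principalLevelSubgroup δ 1) (hb₂ : b₂ ∈ principalLevelSubgroup δ 1)
    (ζ : ℕ → ℂ) (hζ : ∀ ⦃M : ℕ⦄, N ∣ M → M ≠ 0 → IsPrimitiveRoot (ζ M) M)
    (hζ_pow : ∀ ⦃M : ℕ⦄ (k : ℕ), N ∣ M → M ≠ 0 → k ≠ 0 → ζ (k * M) ^ k = ζ M)
    (hpair : ∀ (x : ι) ⦃M : ℕ⦄, N ∣ M → ∀ (hMΩ : (M : ℂ) ≠ 0) (u w : Fin g ⊕ Fin g → ZMod M)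
      (P Q : (A x).torsionPoints ℂ (M : ℤ)),
      (∀ v, AdelicCongr ((b₁⁻¹ : gspFinAdelic δ) : GL (Fin g ⊕ Fin g) finAdeleQ) 1 v
          (fun i => ((u i).val : ℚ) / M) → (P : (A x).Points ℂ) = (m x).r v) →
      (∀ v, AdelicCongr ((b₁⁻¹ : gspFinAdelic δ) : GL (Fin g ⊕ Fin g) finAdeleQ) 1 v
          (fun i => ((w i).val : ℚ) / M) → (Q : (A x).Points ℂ) = (m x).r v) →
      haveI := AbelianVariety.isDominant_toSchemeHom_zsmul_of_ne_zero (A x) hMΩ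
      (A x).weilPairingLevel (Θ x) P Q = ζ M ^ (AbelianSchemeOver.typeFormMod δ M u w).val) :
    ∃ ζ' : ℕ → ℂ, (∀ ⦃M : ℕ⦄, N ∣ M → M ≠ 0 → IsPrimitiveRoot (ζ' M) M) ∧
      (∀ ⦃M : ℕ⦄ (k : ℕ), N ∣ M → M ≠ 0 → k ≠ 0 → ζ' (k * M) ^ k = ζ' M) ∧
      ∀ (x : ι) ⦃M : ℕ⦄, N ∣ M → ∀ (hMΩ : (M : ℂ) ≠ 0) (u w : Fin g ⊕ Fin g → ZMod M)
        (P Q : (A x).torsionPoints ℂ (M : ℤ)),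
        (∀ v, AdelicCongr ((b₂⁻¹ : gspFinAdelic δ) : GL (Fin g ⊕ Fin g) finAdeleQ) 1 v
            (fun i => ((u i).val : ℚ) / M) → (P : (A x).Points ℂ) = (m x).r v) →
        (∀ v, AdelicCongr ((b₂⁻¹ : gspFinAdelic δ) : GL (Fin g ⊕ Fin g) finAdeleQ) 1 v
            (fun i => ((w i).val : ℚ) / M) → (Q : (A x).Points ℂ) = (m x).r v) →
        haveI := AbelianVariety.isDominant_toSchemeHom_zsmul_of_ne_zero (A x) hMΩ
        (A x).weilPairingLevel (Θ x) P Q = ζ' M ^ (AbelianSchemeOver.typeFormMod δ M u w).val := by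
  classical
  -- the transition element `k = b₁⁻¹ b₂ ∈ K_δ(1)` and its similitude tower (independent of the fibre)
  set k : gspFinAdelic δ := b₁⁻¹ * b₂ with hk_def
  have hk : k ∈ principalLevelSubgroup δ 1 := mul_mem (inv_mem hb₁) hb₂
  obtain ⟨Γ, ν, hΓres, -, hνcompat, hsim⟩ := exists_similitudeTower δ hδ hg hk
  -- integrality of `k⁻¹`
  have hint : ∀ i j, ((((k⁻¹ : gspFinAdelic δ) : GL (Fin g ⊕ Fin g) finAdeleQ) :
      Matrix (Fin g ⊕ Fin g) (Fin g ⊕ Fin g) finAdeleQ) i j) ∈ FiniteAdeleRing.integralAdeles (𝓞 ℚ) ℚ := fun i j =>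
    isIntegral_of_isCongOne_one (A := (((k⁻¹ : gspFinAdelic δ) : GL (Fin g ⊕ Fin g) finAdeleQ) :
      Matrix (Fin g ⊕ Fin g) (Fin g ⊕ Fin g) finAdeleQ)) ((mem_principalLevelSubgroup_iff δ).1 (inv_mem hk)).1 i j
  -- the group identities `k⁻¹ b₁⁻¹ = b₂⁻¹`, `k⁻¹ k = 1` in `GL`
  have hGL₁ : ((k⁻¹ : gspFinAdelic δ) : GL (Fin g ⊕ Fin g) finAdeleQ) * ((b₁⁻¹ : gspFinAdelic δ) : GL (Fin g ⊕ Fin g) finAdeleQ) =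
      ((b₂⁻¹ : gspFinAdelic δ) : GL (Fin g ⊕ Fin g) finAdeleQ) := by
    rw [← Subgroup.coe_mul, hk_def, _root_.mul_inv_rev, inv_inv, mul_inv_cancel_right]
  have hGL₂ : ((k⁻¹ : gspFinAdelic δ) : GL (Fin g ⊕ Fin g) finAdeleQ) * ((k : gspFinAdelic δ) : GL (Fin g ⊕ Fin g) finAdeleQ) = 1 := by
    rw [← Subgroup.coe_mul, inv_mul_cancel, Subgroup.coe_one]
  -- at every fibre: a point read at `ũ/M` through `b₂` is read at `(Γ_M u)~/M` through `b₁`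
  have hread : ∀ (x : ι) {M : ℕ} (_ : M ≠ 0) (u : Fin g ⊕ Fin g → ZMod M) (P : (A x).Points ℂ),
      (∀ v, AdelicCongr ((b₂⁻¹ : gspFinAdelic δ) : GL (Fin g ⊕ Fin g) finAdeleQ) 1 v
          (fun i => ((u i).val : ℚ) / M) → P = (m x).r v) →
      ∀ v, AdelicCongr ((b₁⁻¹ : gspFinAdelic δ) : GL (Fin g ⊕ Fin g) finAdeleQ) 1 v
          (fun i => ((((Γ M : Matrix (Fin g ⊕ Fin g) (Fin g ⊕ Fin g) (ZMod M)) *ᵥ u) i).val : ℚ) / M) → P = (m x).r v := by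
    intro x M hM u P hP v hv
    haveI : NeZero M := ⟨hM⟩
    have hres := adelicCongr_val_div_of_entries_residue hk (Γ M : Matrix (Fin g ⊕ Fin g) (Fin g ⊕ Fin g) (ZMod M))
      (hΓres M) u
    have h1 := hv.trans (adelicCongr_comm.1 hres)
    have h2 := h1.mul_left (u := ((k⁻¹ : gspFinAdelic δ) : GL (Fin g ⊕ Fin g) finAdeleQ)) hint
    rw [hGL₁, hGL₂] at h2
    exact hP v h2
  refine ⟨fun M => ζ M ^ ((ν M : ZMod M)).val, fun M hNM hM => ?_, fun M k' hNM hM hk' => ?_,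
    fun x M hNM hMΩ u w P Q hP hQ => ?_⟩
  · -- primitivity: `ν̄_M` is a unit mod `M`
    exact (hζ hNM hM).pow_of_coprime _ (ZMod.val_coe_unit_coprime (ν M))
  · -- compatibility: `(ζ_{kM} ^ ν̄_{kM})^k = ζ_M ^ ν̄_{kM} = ζ_M ^ ν̄_M`
    have hM' : k' * M ≠ 0 := mul_ne_zero hk' hM
    haveI : NeZero M := ⟨hM⟩
    haveI : NeZero (k' * M) := ⟨hM'⟩
    have hval : ((ν M : ZMod M)).val = ((ν (k' * M) : ZMod (k' * M))).val % M := by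
      rw [← hνcompat k' hM hk', ZMod.castHom_apply, ZMod.cast_eq_val, ZMod.val_natCast]
    dsimp only
    rw [← pow_mul, mul_comm ((ν (k' * M) : ZMod (k' * M))).val k', pow_mul, hζ_pow k' hNM hM hk', hval]
    exact pow_eq_pow_mod_of_pow_eq_one (hζ hNM hM).pow_eq_one _
  · -- the pairing at the fibre `x`: read through `b₁` at `Γ_M u`, `Γ_M w`, then use the similitude property of `Γ_M`
    have hM : M ≠ 0 := by rintro rfl; exact hMΩ Nat.cast_zero
    haveI : NeZero M := ⟨hM⟩
    have h := hpair x hNM hMΩ ((Γ M : Matrix (Fin g ⊕ Fin g) (Fin g ⊕ Fin g) (ZMod M)) *ᵥ u)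
      ((Γ M : Matrix (Fin g ⊕ Fin g) (Fin g ⊕ Fin g) (ZMod M)) *ᵥ w) P Q (hread x hM u P hP) (hread x hM w Q hQ)
    dsimp only
    rw [h, hsim hM u w, ZMod.val_mul, ← pow_eq_pow_mod_of_pow_eq_one ((hζ hNM hM).pow_eq_one), pow_mul]

/-! ### §2 (B4): `IsFlatGram ⇒ ∃ ζ, IsFlatPairingReading` for markings with basis matrix `1` -/

/-- **(B4) PAIRING READINGS THROUGH `r` FOR A FAMILY, FROM FRAMES OF TYPE `δ`, WITH ONE SYSTEM OF ROOTS OF UNITY.**  Let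
`m x` mark `A x` by `[J x, r]` (`x : ι`, ONE integral `r ∈ K_δ(1)`) with basis matrices `(m x).γ = 1` (so `(m x).r v = (m x).toFun [ṽ]`),
and let `Θ x` be divisors such that at every `x` the class `[𝒪(Θ x)^an]` read on the marking's OWN uniformisation has an
Appell–Humbert datum with `intGram (m x).Ψ p.form = typeForm δ` (the body of `SiegelMarkingFamily.IsFlatGram Θ`).  Then there is ONE
compatible system of primitive roots `ζ` such that at EVERY `x` the Weil pairing of `Θ x` on `M`-torsion points read at `ũ/M`, `w̃/M`
through `r` is `ζ_M ^ E_δ(u, w)` for every `N ∣ M` (the body of `SiegelMarkingFamily.IsFlatPairingReading Θ N ζ`): through `1` the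
system is `e(2πi/M)` at every fibre (★ `pairingRead_one_of_intGram_eq_typeForm`), and the family change of reading `1 ↦ r` twists it by
the multiplier tower of `r`, the same at every fibre. [cite: Milne2005ShimuraVarieties, §6 Thm. 6.11 pp. 74–75 and §12 (63) p. 116]
[cite: Deligne1971TravauxShimura, 4.12 (b) pp. 148–149 and Exemple 4.16 p. 150] [cite: Lan2013PELCompactifications, §1.3.6 Lemma 1.3.6.5 (p. 81)] -/
theorem exists_pairingRead_forall_of_intGram_eq_typeForm (hδ : IsPolarizationType δ) (hg : 0 < g) {N : ℕ}
    {r : gspFinAdelic δ} (hr1 : r ∈ principalLevelSubgroup δ 1) {J : ι → C0pm δ}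
    (m : ∀ x, SiegelAdelicMarking (J x) r (A x)) (hγ : ∀ x, (m x).γ = 1) (Θ : ∀ x, CartierDivisor (A x).X.left)
    (hgram : ∀ x, ∃ p : AHData (m x).Ψ,
      AHData.toPic p = picClass (cartierDivisorLineBundle (m x).isAnalytification (Θ x)) ∧ intGram (m x).Ψ p.form = typeForm δ) :
    ∃ ζ : ℕ → ℂ, (∀ ⦃M : ℕ⦄, N ∣ M → M ≠ 0 → IsPrimitiveRoot (ζ M) M) ∧
      (∀ ⦃M : ℕ⦄ (k : ℕ), N ∣ M → M ≠ 0 → k ≠ 0 → ζ (k * M) ^ k = ζ M) ∧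
      ∀ (x : ι) ⦃M : ℕ⦄, N ∣ M → ∀ (hMΩ : (M : ℂ) ≠ 0) (u w : Fin g ⊕ Fin g → ZMod M)
        (P Q : (A x).torsionPoints ℂ (M : ℤ)),
        (∀ v, AdelicCongr ((r⁻¹ : gspFinAdelic δ) : GL (Fin g ⊕ Fin g) finAdeleQ) 1 v
            (fun i => ((u i).val : ℚ) / M) → (P : (A x).Points ℂ) = (m x).r v) →
        (∀ v, AdelicCongr ((r⁻¹ : gspFinAdelic δ) : GL (Fin g ⊕ Fin g) finAdeleQ) 1 v
            (fun i => ((w i).val : ℚ) / M) → (Q : (A x).Points ℂ) = (m x).r v) →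
        haveI := AbelianVariety.isDominant_toSchemeHom_zsmul_of_ne_zero (A x) hMΩ
        (A x).weilPairingLevel (Θ x) P Q = ζ M ^ (AbelianSchemeOver.typeFormMod δ M u w).val := by
  -- through `1`: the normal form with `ζ₀_M = e(2πi/M)` at EVERY fibre
  set ζ₀ : ℕ → ℂ := fun M => Complex.exp (2 * Real.pi * Complex.I / M) with hζ₀_def
  have hζ₀ : ∀ ⦃M : ℕ⦄, N ∣ M → M ≠ 0 → IsPrimitiveRoot (ζ₀ M) M := fun M _ hM => Complex.isPrimitiveRoot_exp M hM
  have hζ₀_pow : ∀ ⦃M : ℕ⦄ (k : ℕ), N ∣ M → M ≠ 0 → k ≠ 0 → ζ₀ (k * M) ^ k = ζ₀ M := by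
    intro M k _ hM hk
    have hMc : (M : ℂ) ≠ 0 := Nat.cast_ne_zero.2 hM
    have hkc : (k : ℂ) ≠ 0 := Nat.cast_ne_zero.2 hk
    simp only [hζ₀_def]
    rw [← Complex.exp_nat_mul]
    congr 1
    push_cast
    field_simp
  refine exists_pairingRead_forall_of_pairingRead_forall hδ hg m Θ (one_mem _) hr1 ζ₀ hζ₀ hζ₀_pow fun x => ?_
  obtain ⟨p, hp, hT⟩ := hgram x
  exact (m x).pairingRead_one_of_intGram_eq_typeForm (Θ x) (m x).isAnalytification (m x).toFun_add p hp hT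
    ((m x).r_eq_toFun_proj_of_γ_eq_one (hγ x))

end SiegelAdelicMarking

end Literature.AlgebraicGeometry.ModuliOfAbelianVarieties

end
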